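import Mathlib
import Summits.CriticalPhenomena.Ising3DConformalLimit.Theses.GaussianScaleMixture
import Literature.Probability.LatticeModels.CriticalTwoPointBounds
import Literature.Probability.LatticeModels.CriticalTwoPointLawDimension
import Literature.Probability.LatticeModels.CriticalTwoPointLower
import Literature.Probability.LatticeModels.HighDimPointwiseTriviality

/-!
# Disproof work file — crux `CriticalTwoPointGSM` (stmt-CriticalPhenomena-8365), standing disprover

Crux (route GaussianScaleMixture, r2): the critical two-point function `G(x) = ⟨σ₀σ_x⟩⁺_{β_c}` of the
n.n. Ising model on `ℤ³` is a Gaussian scale mixture,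
`G(x) = ∫ exp(-∑ sᵢ xᵢ²) dν(s)`, `ν` an exchangeable probability measure on the closed octant.

(findings and index: see the bottom docblock `Findings`, kept current by the disprover)
-/

namespace Summit.CriticalPhenomena.Ising3DConformalLimit.Cruxes.CriticalTwoPointGSM.Disproof

open MeasureTheory Filter Topology
open Literature.Probability.LatticeModels
open Summit.CriticalPhenomena.Ising3DConformalLimit.Theses.GaussianScaleMixture (CriticalTwoPointGSM)
open scoped BigOperators

noncomputable section

/-- The Gaussian kernel integrand of the crux, `exp(-∑ᵢ sᵢ xᵢ²)` (verbatim the crux's integrand). -/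
def gk (x : Site 3) (s : Fin 3 → ℝ) : ℝ := Real.exp (-∑ i, s i * ((x i : ℝ)) ^ 2)

/-- A GSM representation of the critical two-point function by a finite measure on the closed
octant — the crux with the probability normalisation and the exchangeability clause DROPPED
(both are shown to be free below). -/
def IsGSMRep (ν : Measure (Fin 3 → ℝ)) : Prop :=
  IsFiniteMeasure ν ∧ ν {s | ∃ i, s i < 0} = 0 ∧
    ∀ x : Site 3, criticalTwoPoint 3 x = ∫ s, Real.exp (-∑ i, s i * ((x i : ℝ)) ^ 2) ∂ν

theorem rep_of_gsm (h : CriticalTwoPointGSM) :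
    ∃ ν : Measure (Fin 3 → ℝ), IsProbabilityMeasure ν ∧
      (∀ σ : Equiv.Perm (Fin 3), ν.map (fun s : Fin 3 → ℝ => s ∘ σ) = ν) ∧ IsGSMRep ν := by
  obtain ⟨ν, hP, hoct, hex, hrep⟩ := h
  exact ⟨ν, hP, hex, ⟨inferInstance, hoct, hrep⟩⟩

/-! ## Basic measure-theoretic plumbing -/

theorem ae_nonneg_of_octant {ν : Measure (Fin 3 → ℝ)} (hoct : ν {s | ∃ i, s i < 0} = 0) :
    ∀ᵐ s ∂ν, ∀ i, 0 ≤ s i := by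
  rw [ae_iff]
  have : {a : Fin 3 → ℝ | ¬∀ (i : Fin 3), 0 ≤ a i} = {s | ∃ i, s i < 0} := by
    ext s; simp [not_le]
  rw [this]; exact hoct

theorem gk_pos (x : Site 3) (s : Fin 3 → ℝ) : 0 < gk x s := Real.exp_pos _

theorem gk_le_one (x : Site 3) {s : Fin 3 → ℝ} (hs : ∀ i, 0 ≤ s i) : gk x s ≤ 1 := by
  unfold gk
  rw [Real.exp_le_one_iff]
  have : 0 ≤ ∑ i, s i * ((x i : ℝ)) ^ 2 :=
    Finset.sum_nonneg fun i _ => mul_nonneg (hs i) (sq_nonneg _)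
  linarith

theorem continuous_gk (x : Site 3) : Continuous (gk x) := by
  unfold gk; fun_prop

theorem integrable_gk {ν : Measure (Fin 3 → ℝ)} [IsFiniteMeasure ν]
    (hoct : ν {s | ∃ i, s i < 0} = 0) (x : Site 3) : Integrable (gk x) ν := by
  refine Integrable.mono' (integrable_const (1 : ℝ)) (continuous_gk x).aestronglyMeasurable ?_
  filter_upwards [ae_nonneg_of_octant hoct] with s hs
  rw [Real.norm_eq_abs, abs_of_pos (gk_pos x s)]
  exact gk_le_one x hs

/-! ## The dual cone (kill switch): every kernel-positive finite combination is `G`-positive -/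

/-- **Dual-cone inequality.** If `G` has a GSM representation then for every finite family of
lattice points `x k` and real coefficients `c k` such that `∑ c_k exp(-∑ sᵢ (x k)ᵢ²) ≥ 0` on the
closed octant, `∑ c_k G(x k) ≥ 0`. ONE measured violation of ONE such inequality refutes the crux;
conversely (Riesz extension / Haviland on `[0,1]³`, not formalised) these inequalities characterise
the closure of the GSM cone. -/
theorem dual_cone {ν : Measure (Fin 3 → ℝ)} (h : IsGSMRep ν) {m : ℕ} (c : Fin m → ℝ)
    (x : Fin m → Site 3)
    (hpos : ∀ s : Fin 3 → ℝ, (∀ i, 0 ≤ s i) → 0 ≤ ∑ k, c k * gk (x k) s) :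
    0 ≤ ∑ k, c k * criticalTwoPoint 3 (x k) := by
  obtain ⟨hfin, hoct, hrep⟩ := h
  have hint : ∀ k, Integrable (gk (x k)) ν := fun k => integrable_gk hoct (x k)
  have h1 : ∑ k, c k * criticalTwoPoint 3 (x k) = ∑ k, c k * ∫ s, gk (x k) s ∂ν := by
    refine Finset.sum_congr rfl fun k _ => ?_
    rw [hrep (x k)]; rfl
  have h2 : ∑ k, c k * ∫ s, gk (x k) s ∂ν = ∫ s, ∑ k, c k * gk (x k) s ∂ν := by
    rw [integral_finsetSum _ (fun k _ => (hint k).const_mul (c k))]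
    refine Finset.sum_congr rfl fun k _ => ?_
    rw [integral_const_mul]
  rw [h1, h2]
  apply integral_nonneg_of_ae
  filter_upwards [ae_nonneg_of_octant hoct] with s hs using hpos s hs

/-- The same with the crux as hypothesis. -/
theorem dual_cone_of_gsm (h : CriticalTwoPointGSM) {m : ℕ} (c : Fin m → ℝ) (x : Fin m → Site 3)
    (hpos : ∀ s : Fin 3 → ℝ, (∀ i, 0 ≤ s i) → 0 ≤ ∑ k, c k * gk (x k) s) :
    0 ≤ ∑ k, c k * criticalTwoPoint 3 (x k) := by
  obtain ⟨ν, -, -, hrep⟩ := rep_of_gsm h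
  exact dual_cone hrep c x hpos


/-! ## Evaluating the kernel at concrete lattice points -/

theorem gk_eq (x : Site 3) (s : Fin 3 → ℝ) :
    gk x s = Real.exp (-(s 0 * ((x 0 : ℝ)) ^ 2)) * Real.exp (-(s 1 * ((x 1 : ℝ)) ^ 2)) *
      Real.exp (-(s 2 * ((x 2 : ℝ)) ^ 2)) := by
  rw [← Real.exp_add, ← Real.exp_add]
  unfold gk
  congr 1
  simp only [Fin.sum_univ_three]
  ring

/-- Jensen for `exp` at three points (used for the Muirhead / Schur instances). -/
theorem exp_jensen3 (a b c wa wb wc : ℝ) (ha : 0 ≤ wa) (hb : 0 ≤ wb) (hc : 0 ≤ wc)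
    (hw : wa + wb + wc = 1) :
    Real.exp (wa * a + wb * b + wc * c) ≤ wa * Real.exp a + wb * Real.exp b + wc * Real.exp c := by
  have := convexOn_exp.map_sum_le (t := Finset.univ) (w := ![wa, wb, wc]) (p := ![a, b, c])
    (by intro i _; fin_cases i <;> simp [ha, hb, hc]) (by simp [Fin.sum_univ_three, hw])
    (by intro i _; simp)
  simpa [Fin.sum_univ_three] using this

/-- Permutation symmetry of the critical two-point function (tree: Friedli–Velenik Ex. 3.14). -/
theorem G_perm (π : Equiv.Perm (Fin 3)) (x : Site 3) :
    criticalTwoPoint 3 (fun i => x (π i)) = criticalTwoPoint 3 x :=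
  twoPointPlus_perm_invariant_holds (criticalBeta_nonneg 3) π x

/-! ## Instances of the dual cone: the cheapest measured quantities that would kill the crux

Each is `CriticalTwoPointGSM → (explicit inequality between values of G at |x| ≤ 3)`; a Monte-Carlo /
series estimate violating it by many standard errors is an evidence-file refutation, an exact
violation a Lean refutation. -/

/-- The planner's example of a JOINT mixed second difference that no known correlation inequality
signs: GSM ⇒ `G(2,0,0) + G(1,1,0) ≤ G(1,0,0) + G(2,1,0)`
(kernel side: `e^{-s₀} + e^{-4s₀-s₁} - e^{-4s₀} - e^{-s₀-s₁} = (e^{-s₀} - e^{-4s₀})(1 - e^{-s₁}) ≥ 0`). -/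
theorem mixedDiff_le (h : CriticalTwoPointGSM) :
    criticalTwoPoint 3 ![2, 0, 0] + criticalTwoPoint 3 ![1, 1, 0] ≤
      criticalTwoPoint 3 ![1, 0, 0] + criticalTwoPoint 3 ![2, 1, 0] := by
  have key := dual_cone_of_gsm h ![1, 1, -1, -1] ![![1, 0, 0], ![2, 1, 0], ![2, 0, 0], ![1, 1, 0]]
    (by
      intro s hs
      have e1 : gk ![1, 0, 0] s = Real.exp (-s 0) := by
        rw [gk_eq]; simp
      have e2 : gk ![2, 1, 0] s = Real.exp (-s 0) ^ 4 * Real.exp (-s 1) := by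
        rw [gk_eq, ← Real.exp_nat_mul]; simp; ring_nf
      have e3 : gk ![2, 0, 0] s = Real.exp (-s 0) ^ 4 := by
        rw [gk_eq, ← Real.exp_nat_mul]; simp; ring_nf
      have e4 : gk ![1, 1, 0] s = Real.exp (-s 0) * Real.exp (-s 1) := by
        rw [gk_eq]; simp
      simp only [Fin.sum_univ_four, Matrix.cons_val_zero, Matrix.cons_val_one, Matrix.head_cons,
        Matrix.cons_val_two, Matrix.tail_cons, Matrix.cons_val_three, e1, e2, e3, e4]
      have h0 : Real.exp (-s 0) ≤ 1 := Real.exp_le_one_iff.mpr (by linarith [hs 0])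
      have h1 : Real.exp (-s 1) ≤ 1 := Real.exp_le_one_iff.mpr (by linarith [hs 1])
      have p0 : 0 < Real.exp (-s 0) := Real.exp_pos _
      have : 0 ≤ (Real.exp (-s 0) - Real.exp (-s 0) ^ 4) * (1 - Real.exp (-s 1)) := by
        apply mul_nonneg _ (by linarith)
        nlinarith [pow_le_one₀ p0.le h0 (n := 3)]
      nlinarith [this])
  simp [Fin.sum_univ_four] at key
  linarith

/-- Schur order on the Euclidean sphere `|x|² = 9`: GSM ⇒ `G(2,2,1) ≤ G(3,0,0)` (Muirhead
`(9,0,0) ≻ (4,4,1)` in the variables `tᵢ = e^{-sᵢ}`, via three weighted AM–GM / Jensen steps and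
the permutation symmetry of `G`). The predicted sign of the 3D anisotropy (axes favoured,
Hasenbusch 2021) agrees; the planner's MC estimate of the gap is ≈ 2·10⁻³. -/
theorem schur_221_le_300 (h : CriticalTwoPointGSM) :
    criticalTwoPoint 3 ![2, 2, 1] ≤ criticalTwoPoint 3 ![3, 0, 0] := by
  -- the two permutation orbits
  have p1 : criticalTwoPoint 3 ![0, 3, 0] = criticalTwoPoint 3 ![3, 0, 0] := by
    rw [← G_perm (Equiv.swap 0 1) ![3, 0, 0]]; congr 1; funext i; fin_cases i <;> rfl
  have p2 : criticalTwoPoint 3 ![0, 0, 3] = criticalTwoPoint 3 ![3, 0, 0] := by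
    rw [← G_perm (Equiv.swap 0 2) ![3, 0, 0]]; congr 1; funext i; fin_cases i <;> rfl
  have q1 : criticalTwoPoint 3 ![2, 1, 2] = criticalTwoPoint 3 ![2, 2, 1] := by
    rw [← G_perm (Equiv.swap 1 2) ![2, 2, 1]]; congr 1; funext i; fin_cases i <;> rfl
  have q2 : criticalTwoPoint 3 ![1, 2, 2] = criticalTwoPoint 3 ![2, 2, 1] := by
    rw [← G_perm (Equiv.swap 0 2) ![2, 2, 1]]; congr 1; funext i; fin_cases i <;> rfl
  have key := dual_cone_of_gsm h ![1, 1, 1, -1, -1, -1]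
    ![![3, 0, 0], ![0, 3, 0], ![0, 0, 3], ![2, 2, 1], ![2, 1, 2], ![1, 2, 2]]
    (by
      intro s hs
      set a := -s 0 with ha
      set b := -s 1 with hb
      set c := -s 2 with hc
      have e1 : gk ![3, 0, 0] s = Real.exp (9 * a) := by rw [gk_eq]; simp [ha]; ring_nf
      have e2 : gk ![0, 3, 0] s = Real.exp (9 * b) := by rw [gk_eq]; simp [hb]; ring_nf
      have e3 : gk ![0, 0, 3] s = Real.exp (9 * c) := by rw [gk_eq]; simp [hc]; ring_nf
      have e4 : gk ![2, 2, 1] s = Real.exp (4 * a + 4 * b + c) := by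
        rw [gk_eq, ← Real.exp_add, ← Real.exp_add]; simp [ha, hb, hc]; ring_nf
      have e5 : gk ![2, 1, 2] s = Real.exp (4 * a + b + 4 * c) := by
        rw [gk_eq, ← Real.exp_add, ← Real.exp_add]; simp [ha, hb, hc]; ring_nf
      have e6 : gk ![1, 2, 2] s = Real.exp (a + 4 * b + 4 * c) := by
        rw [gk_eq, ← Real.exp_add, ← Real.exp_add]; simp [ha, hb, hc]; ring_nf
      simp only [Fin.sum_univ_succ, Fin.sum_univ_zero, Matrix.cons_val_zero, Matrix.cons_val_succ,
        e1, e2, e3, e4, e5, e6]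
      have j1 := exp_jensen3 (9 * a) (9 * b) (9 * c) (4/9) (4/9) (1/9) (by norm_num) (by norm_num)
        (by norm_num) (by norm_num)
      have j2 := exp_jensen3 (9 * a) (9 * b) (9 * c) (4/9) (1/9) (4/9) (by norm_num) (by norm_num)
        (by norm_num) (by norm_num)
      have j3 := exp_jensen3 (9 * a) (9 * b) (9 * c) (1/9) (4/9) (4/9) (by norm_num) (by norm_num)
        (by norm_num) (by norm_num)
      have r1 : (4/9 : ℝ) * (9 * a) + 4/9 * (9 * b) + 1/9 * (9 * c) = 4 * a + 4 * b + c := by ring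
      have r2 : (4/9 : ℝ) * (9 * a) + 1/9 * (9 * b) + 4/9 * (9 * c) = 4 * a + b + 4 * c := by ring
      have r3 : (1/9 : ℝ) * (9 * a) + 4/9 * (9 * b) + 4/9 * (9 * c) = a + 4 * b + 4 * c := by ring
      rw [r1] at j1; rw [r2] at j2; rw [r3] at j3
      simp
      linarith)
  simp [Fin.sum_univ_succ, p1, p2, q1, q2] at key
  linarith


/-! ## Structure forced on ANY mixing measure by the tree's rigorous facts
(`criticalTwoPoint_bounds_holds`: `c‖x‖∞⁻² ≤ G(x) ≤ C‖x‖∞⁻¹`; `criticalTwoPoint_tendsto_zero_cofinite`). -/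

theorem sum_single_sq (s : Fin 3 → ℝ) (i : Fin 3) (n : ℤ) :
    ∑ j, s j * (((Pi.single i n : Site 3) j : ℝ)) ^ 2 = s i * (n : ℝ) ^ 2 := by
  rw [Finset.sum_eq_single i]
  · simp
  · intro j _ hj; simp [Pi.single_eq_of_ne hj]
  · intro h; exact absurd (Finset.mem_univ i) h

theorem gk_single (s : Fin 3 → ℝ) (i : Fin 3) (n : ℤ) :
    gk (Pi.single i n) s = Real.exp (-(s i * (n : ℝ) ^ 2)) := by
  unfold gk; rw [sum_single_sq]

theorem single_ne_zero (i : Fin 3) {n : ℕ} (hn : 1 ≤ n) : (Pi.single i (n : ℤ) : Site 3) ≠ 0 := by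
  intro h
  have := congrFun h i
  simp at this
  omega

/-- `G(n eᵢ) → 0` (from `criticalTwoPoint_tendsto_zero_cofinite`). -/
theorem G_axis_tendsto_zero (i : Fin 3) :
    Tendsto (fun n : ℕ => criticalTwoPoint 3 (Pi.single i (n : ℤ))) atTop (𝓝 0) := by
  refine criticalTwoPoint_tendsto_zero_cofinite.comp ?_
  rw [← Nat.cofinite_eq_atTop]
  refine Function.Injective.tendsto_cofinite fun a b hab => ?_
  have := congrFun hab i
  simpa using this

/-- The tree's lower bound along an axis: `c n⁻² ≤ G(n eᵢ)`, packaged as `c ≤ n² G(n eᵢ)`. -/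
theorem axis_lower_bound : ∃ c : ℝ, 0 < c ∧ ∀ (i : Fin 3) (n : ℕ), 1 ≤ n →
    c ≤ (n : ℝ) ^ 2 * criticalTwoPoint 3 (Pi.single i (n : ℤ)) := by
  obtain ⟨c, C, hc, hbd⟩ := criticalTwoPoint_bounds_holds (d := 3) (by norm_num)
  refine ⟨c, hc, fun i n hn => ?_⟩
  have h := (hbd _ (single_ne_zero i hn)).1
  rw [Pi.norm_single, Int.norm_natCast] at h
  have hnpos : (0 : ℝ) < n := by exact_mod_cast hn
  have e : ((n : ℝ)) ^ (-(((3 : ℕ) : ℝ) - 1)) = ((n : ℝ) ^ 2)⁻¹ := by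
    rw [show (-(((3 : ℕ) : ℝ) - 1)) = -(2 : ℝ) by norm_num, Real.rpow_neg hnpos.le, Real.rpow_two]
  rw [e] at h
  have h2 : 0 < (n : ℝ) ^ 2 := by positivity
  calc c = (n : ℝ) ^ 2 * (c * ((n : ℝ) ^ 2)⁻¹) := by field_simp
    _ ≤ (n : ℝ) ^ 2 * criticalTwoPoint 3 (Pi.single i (n : ℤ)) :=
        mul_le_mul_of_nonneg_left h h2.le

/-- Hence `n² G(n eᵢ) ↛ 0`: any candidate for `G` that is `o(n⁻²)` along an axis is dead. -/
theorem false_of_sq_mul_axis_tendsto_zero (i : Fin 3)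
    (h : Tendsto (fun n : ℕ => (n : ℝ) ^ 2 * criticalTwoPoint 3 (Pi.single i (n : ℤ))) atTop (𝓝 0)) :
    False := by
  obtain ⟨c, hc, hlb⟩ := axis_lower_bound
  have : c ≤ 0 :=
    ge_of_tendsto h (Filter.eventually_atTop.mpr ⟨1, fun n hn => hlb i n hn⟩)
  linarith

/-- `n² e^{-ε n²} → 0`. -/
theorem tendsto_sq_mul_exp_neg {ε : ℝ} (hε : 0 < ε) :
    Tendsto (fun n : ℕ => (n : ℝ) ^ 2 * Real.exp (-(ε * (n : ℝ) ^ 2))) atTop (𝓝 0) := by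
  have h1 : Tendsto (fun n : ℕ => ε * (n : ℝ) ^ 2) atTop atTop :=
    Tendsto.const_mul_atTop hε ((tendsto_pow_atTop two_ne_zero).comp tendsto_natCast_atTop_atTop)
  have h2 := (Real.tendsto_pow_mul_exp_neg_atTop_nhds_zero 1).comp h1
  have h3 := h2.const_mul ε⁻¹
  rw [mul_zero] at h3
  refine h3.congr fun n => ?_
  simp only [Function.comp_apply, pow_one]
  field_simp

/-- **(B1) No mass on the coordinate planes**: every GSM representing measure is carried by the OPEN
octant, `ν{sᵢ = 0} = 0` — because `G(n eᵢ) = ∫ e^{-sᵢn²}dν → ν{sᵢ = 0}` (dominated convergence)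
while `G(n eᵢ) → 0`. In particular "isotropic part + constant" decompositions are excluded. -/
theorem measure_plane_eq_zero {ν : Measure (Fin 3 → ℝ)} (h : IsGSMRep ν) (i : Fin 3) :
    ν {s | s i = 0} = 0 := by
  obtain ⟨hfin, hoct, hrep⟩ := h
  have hmeas : MeasurableSet {s : Fin 3 → ℝ | s i = 0} :=
    measurableSet_eq_fun (measurable_pi_apply i) measurable_const
  have hlim : Tendsto (fun n : ℕ => ∫ s, gk (Pi.single i (n : ℤ)) s ∂ν) atTop
      (𝓝 (∫ s, Set.indicator {s : Fin 3 → ℝ | s i = 0} (1 : (Fin 3 → ℝ) → ℝ) s ∂ν)) := by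
    refine tendsto_integral_of_dominated_convergence (fun _ => (1 : ℝ))
      (fun n => (continuous_gk _).aestronglyMeasurable) (integrable_const 1) ?_ ?_
    · intro n
      filter_upwards [ae_nonneg_of_octant hoct] with s hs
      rw [Real.norm_eq_abs, abs_of_pos (gk_pos _ s)]
      exact gk_le_one _ hs
    · filter_upwards [ae_nonneg_of_octant hoct] with s hs
      by_cases h0 : s i = 0
      · have hc : ∀ n : ℕ, gk (Pi.single i (n : ℤ)) s = 1 := by
          intro n; rw [gk_single, h0]; simp
        simp only [hc, Set.indicator_of_mem (show s ∈ {s : Fin 3 → ℝ | s i = 0} from h0),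
          Pi.one_apply]
        exact tendsto_const_nhds
      · have hpos : 0 < s i := lt_of_le_of_ne (hs i) (Ne.symm h0)
        rw [Set.indicator_of_notMem (show s ∉ {s : Fin 3 → ℝ | s i = 0} from h0)]
        have e : (fun n : ℕ => gk (Pi.single i (n : ℤ)) s) =
            fun n : ℕ => Real.exp (-(s i * (n : ℝ) ^ 2)) := by
          funext n; rw [gk_single]; push_cast; ring_nf
        rw [e]
        refine Real.tendsto_exp_atBot.comp ?_
        rw [tendsto_neg_atBot_iff]
        exact Tendsto.const_mul_atTop hpos
          ((tendsto_pow_atTop two_ne_zero).comp tendsto_natCast_atTop_atTop)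
  rw [integral_indicator_one hmeas] at hlim
  have hlim' : Tendsto (fun n : ℕ => criticalTwoPoint 3 (Pi.single i (n : ℤ))) atTop
      (𝓝 ((ν {s | s i = 0}).toReal)) := by
    refine hlim.congr fun n => ?_
    rw [hrep]; rfl
  have h0 := tendsto_nhds_unique hlim' (G_axis_tendsto_zero i)
  exact ((ENNReal.toReal_eq_zero_iff _).mp h0).resolve_right (measure_ne_top ν _)

/-- **(B2) Mass accumulates at every coordinate plane**: `ν{sᵢ < ε} > 0` for every `ε > 0` —
otherwise `G(n eᵢ) ≤ ν(ℝ³) e^{-ε n²}`, against Simon's lower bound `c n⁻²`. So `ν` is NOT boundedly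
supported away from the planes: arbitrarily FLAT Gaussians (long clocks) are charged; with (B1) the
support of every marginal accumulates at `0` without charging it. -/
theorem measure_near_plane_ne_zero {ν : Measure (Fin 3 → ℝ)} (h : IsGSMRep ν) (i : Fin 3)
    {ε : ℝ} (hε : 0 < ε) : ν {s | s i < ε} ≠ 0 := by
  obtain ⟨hfin, hoct, hrep⟩ := h
  intro h0
  have hae : ∀ᵐ s ∂ν, ε ≤ s i := by
    rw [ae_iff]; simpa [not_le] using h0
  set M := (ν Set.univ).toReal with hM
  have hub : ∀ n : ℕ, criticalTwoPoint 3 (Pi.single i (n : ℤ)) ≤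
      M * Real.exp (-(ε * (n : ℝ) ^ 2)) := by
    intro n
    have h1 : ∫ s, gk (Pi.single i (n : ℤ)) s ∂ν ≤ ∫ _s, Real.exp (-(ε * (n : ℝ) ^ 2)) ∂ν := by
      refine integral_mono_ae (integrable_gk hoct _) (integrable_const _) ?_
      filter_upwards [hae] with s hs
      rw [gk_single]
      push_cast
      apply Real.exp_le_exp.mpr
      nlinarith [sq_nonneg (n : ℝ)]
    rw [integral_const, smul_eq_mul] at h1
    rw [hrep]
    calc _ = ∫ s, gk (Pi.single i (n : ℤ)) s ∂ν := rfl
      _ ≤ _ := h1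
      _ = M * Real.exp (-(ε * (n : ℝ) ^ 2)) := by rw [hM]; rfl
  have hlim : Tendsto (fun n : ℕ => M * ((n : ℝ) ^ 2 * Real.exp (-(ε * (n : ℝ) ^ 2)))) atTop
      (𝓝 0) := by
    simpa using (tendsto_sq_mul_exp_neg hε).const_mul M
  refine false_of_sq_mul_axis_tendsto_zero i ?_
  refine squeeze_zero (fun n => mul_nonneg (sq_nonneg _) (criticalTwoPoint_nonneg' _))
    (fun n => ?_) hlim
  calc _ ≤ (n : ℝ) ^ 2 * (M * Real.exp (-(ε * (n : ℝ) ^ 2))) :=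
        mul_le_mul_of_nonneg_left (hub n) (sq_nonneg _)
    _ = _ := by ring

/-! ## Refuted natural strengthenings -/

/-- STRENGTHENING S1 — a FINITE Gaussian mixture (finitely many axis-aligned Gaussian kernels with
nonnegative weights, exchangeable or not). -/
def CriticalTwoPointFiniteGSM : Prop :=
  ∃ (m : ℕ) (w : Fin m → ℝ) (a : Fin m → (Fin 3 → ℝ)), (∀ k, 0 ≤ w k) ∧ (∀ k i, 0 ≤ a k i) ∧
    ∀ x : Site 3, criticalTwoPoint 3 x = ∑ k, w k * Real.exp (-∑ i, a k i * ((x i : ℝ)) ^ 2)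

/-- **S1 is false**: a finite mixture is either bounded below by a positive weight along an axis
(an atom with `aₖ₀ = 0`, against `G(n e₀) → 0`) or Gaussian-small there (against `c n⁻²`). Any GSM
representing measure has infinitely many "clocks" accumulating at every coordinate plane. -/
theorem not_finiteGSM : ¬ CriticalTwoPointFiniteGSM := by
  rintro ⟨m, w, a, hw, ha, hrep⟩
  have hrep0 : ∀ n : ℕ, criticalTwoPoint 3 (Pi.single 0 (n : ℤ)) =
      ∑ k, w k * Real.exp (-(a k 0 * (n : ℝ) ^ 2)) := by
    intro n; rw [hrep]
    refine Finset.sum_congr rfl fun k _ => ?_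
    rw [sum_single_sq, Int.cast_natCast]
  -- atoms on the plane `a k 0 = 0` carry no weight
  have hzero : ∀ k, a k 0 = 0 → w k = 0 := by
    intro k hk
    have hle : ∀ n : ℕ, w k ≤ criticalTwoPoint 3 (Pi.single 0 (n : ℤ)) := by
      intro n
      rw [hrep0]
      calc w k = w k * Real.exp (-(a k 0 * (n : ℝ) ^ 2)) := by rw [hk]; simp
        _ ≤ ∑ j, w j * Real.exp (-(a j 0 * (n : ℝ) ^ 2)) :=
          Finset.single_le_sum (f := fun j => w j * Real.exp (-(a j 0 * (n : ℝ) ^ 2)))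
            (fun j _ => mul_nonneg (hw j) (Real.exp_pos _).le) (Finset.mem_univ k)
    have : w k ≤ 0 := ge_of_tendsto (G_axis_tendsto_zero 0) (Eventually.of_forall hle)
    exact le_antisymm this (hw k)
  -- hence every term `w k · n² e^{-a_{k0} n²}` tends to zero, and so does `n² G(n e₀)`
  have hterm : ∀ k, Tendsto (fun n : ℕ => w k * ((n : ℝ) ^ 2 * Real.exp (-(a k 0 * (n : ℝ) ^ 2))))
      atTop (𝓝 0) := by
    intro k
    rcases (ha k 0).eq_or_lt with h0 | hpos
    · have hw0 : w k = 0 := hzero k h0.symm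
      simp only [hw0, zero_mul]
      exact tendsto_const_nhds
    · simpa using (tendsto_sq_mul_exp_neg hpos).const_mul (w k)
  refine false_of_sq_mul_axis_tendsto_zero 0 ?_
  have e : (fun n : ℕ => (n : ℝ) ^ 2 * criticalTwoPoint 3 (Pi.single 0 (n : ℤ))) =
      fun n : ℕ => ∑ k, w k * ((n : ℝ) ^ 2 * Real.exp (-(a k 0 * (n : ℝ) ^ 2))) := by
    funext n; rw [hrep0, Finset.mul_sum]; refine Finset.sum_congr rfl fun k _ => ?_; ring
  rw [e, show (0 : ℝ) = ∑ _k : Fin m, (0 : ℝ) by simp]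
  exact tendsto_finsetSum _ fun k _ => hterm k

/-- STRENGTHENING S2 — `ν` a PRODUCT measure (three INDEPENDENT clocks), equivalently `G`
multiplicatively separable `G(x) = g(x₀) g(x₁) g(x₂)`. -/
def CriticalTwoPointProductForm : Prop :=
  ∃ g : ℤ → ℝ, ∀ x : Site 3, criticalTwoPoint 3 x = g (x 0) * g (x 1) * g (x 2)

/-- **S2 is false**: separability forces `G(n,n,n) = G(n,0,0)³ ≤ C³ n⁻³`, against the lower bound
`c‖(n,n,n)‖∞⁻² = c n⁻²`. The three clocks of any GSM representation are genuinely DEPENDENT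
(positively correlated: cf. the high-temperature heuristics `E[t₁t₂] = 2E[t₁]E[t₂]` in the notes). -/
theorem not_productForm : ¬ CriticalTwoPointProductForm := by
  rintro ⟨g, hg⟩
  obtain ⟨c, C, hc, hbd⟩ := criticalTwoPoint_bounds_holds (d := 3) (by norm_num)
  have hg0 : g 0 ^ 6 = 1 := by
    have h := hg 0
    rw [criticalTwoPoint_zero'] at h
    simp only [Pi.zero_apply] at h
    nlinarith [h]
  -- G(n,n,n) = G(n,0,0)^3
  have hcube : ∀ n : ℤ, criticalTwoPoint 3 (fun _ => n) = criticalTwoPoint 3 (Pi.single 0 n) ^ 3 := by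
    intro n
    rw [hg (fun _ => n), hg (Pi.single 0 n)]
    simp only [Pi.single_eq_same, Pi.single_eq_of_ne (show (1 : Fin 3) ≠ 0 by decide),
      Pi.single_eq_of_ne (show (2 : Fin 3) ≠ 0 by decide)]
    calc g n * g n * g n = g n ^ 3 * 1 := by ring
      _ = g n ^ 3 * g 0 ^ 6 := by rw [hg0]
      _ = (g n * g 0 * g 0) ^ 3 := by ring
  -- bounds along the diagonal and the axis
  have key : ∀ n : ℕ, 1 ≤ n → c * (n : ℝ) ≤ C ^ 3 := by
    intro n hn
    have hnpos : (0 : ℝ) < n := by exact_mod_cast hn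
    have hdiag_ne : (fun _ => (n : ℤ) : Site 3) ≠ 0 := by
      intro h; have := congrFun h 0; simp at this; omega
    have hl := (hbd _ hdiag_ne).1
    have hu := (hbd _ (single_ne_zero 0 hn)).2
    rw [pi_norm_const, Int.norm_natCast] at hl
    rw [Pi.norm_single, Int.norm_natCast] at hu
    rw [show (-(((3 : ℕ) : ℝ) - 1)) = -(2 : ℝ) by norm_num, Real.rpow_neg hnpos.le,
      Real.rpow_two] at hl
    rw [show (-(((3 : ℕ) : ℝ) - 2)) = -(1 : ℝ) by norm_num, Real.rpow_neg hnpos.le,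
      Real.rpow_one] at hu
    have hG0 : 0 ≤ criticalTwoPoint 3 (Pi.single 0 (n : ℤ)) := criticalTwoPoint_nonneg' _
    have hu3 : criticalTwoPoint 3 (Pi.single 0 (n : ℤ)) ^ 3 ≤ (C * ((n : ℝ))⁻¹) ^ 3 :=
      pow_le_pow_left₀ hG0 hu 3
    rw [← hcube] at hu3
    have h1 : c * ((n : ℝ) ^ 2)⁻¹ ≤ C ^ 3 * ((n : ℝ) ^ 3)⁻¹ := by
      calc _ ≤ _ := hl
        _ ≤ _ := hu3
        _ = _ := by ring
    have h3 : (0 : ℝ) < (n : ℝ) ^ 3 := by positivity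
    have := mul_le_mul_of_nonneg_right h1 h3.le
    calc c * (n : ℝ) = c * ((n : ℝ) ^ 2)⁻¹ * (n : ℝ) ^ 3 := by field_simp
      _ ≤ C ^ 3 * ((n : ℝ) ^ 3)⁻¹ * (n : ℝ) ^ 3 := this
      _ = C ^ 3 := by field_simp
  obtain ⟨N, hN⟩ := exists_nat_gt (C ^ 3 / c)
  have h1 := key (max N 1) (le_max_right _ _)
  have h2 : C ^ 3 / c < (max N 1 : ℕ) := hN.trans_le (by exact_mod_cast le_max_left N 1)
  rw [div_lt_iff₀ hc] at h2
  linarith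


/-! ## Exchangeability and normalisation are free (not load-bearing)

`gsm_of_rep`: ANY finite octant measure representing `G` on `ℤ³` yields the crux (symmetrise over
`S₃`; total mass is `G(0) = 1`). So provers may construct `ν` without either clause, and a disproof
may ignore them. -/

/-- Coordinate permutation of the parameter octant. -/
def permS (σ : Equiv.Perm (Fin 3)) : (Fin 3 → ℝ) → (Fin 3 → ℝ) := fun s => s ∘ σ

theorem measurable_permS (σ : Equiv.Perm (Fin 3)) : Measurable (permS σ) :=
  measurable_pi_lambda _ fun i => measurable_pi_apply (σ i)

theorem permS_comp (σ τ : Equiv.Perm (Fin 3)) : permS τ ∘ permS σ = permS (σ * τ) := rfl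

/-- The octant-defect set is permutation invariant and measurable. -/
theorem negSet_eq_iUnion : {s : Fin 3 → ℝ | ∃ i, s i < 0} = ⋃ i, {s | s i < 0} := by
  ext s; simp

theorem measurableSet_negSet : MeasurableSet {s : Fin 3 → ℝ | ∃ i, s i < 0} := by
  rw [negSet_eq_iUnion]
  exact MeasurableSet.iUnion fun i => measurableSet_lt (measurable_pi_apply i) measurable_const

theorem preimage_permS_negSet (σ : Equiv.Perm (Fin 3)) :
    permS σ ⁻¹' {s : Fin 3 → ℝ | ∃ i, s i < 0} = {s | ∃ i, s i < 0} := by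
  ext s
  simp only [Set.mem_preimage, Set.mem_setOf_eq, permS, Function.comp_apply]
  constructor
  · rintro ⟨i, hi⟩; exact ⟨σ i, hi⟩
  · rintro ⟨i, hi⟩; exact ⟨σ.symm i, by simpa using hi⟩

/-- The `S₃`-symmetrisation of a measure on the parameter space. -/
def symmMeasure (ν : Measure (Fin 3 → ℝ)) : Measure (Fin 3 → ℝ) :=
  ((Fintype.card (Equiv.Perm (Fin 3)) : ENNReal)⁻¹) • ∑ σ : Equiv.Perm (Fin 3), ν.map (permS σ)

theorem symmMeasure_apply (ν : Measure (Fin 3 → ℝ)) {S : Set (Fin 3 → ℝ)} (hS : MeasurableSet S) :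
    symmMeasure ν S =
      ((Fintype.card (Equiv.Perm (Fin 3)) : ENNReal)⁻¹) * ∑ σ : Equiv.Perm (Fin 3), ν (permS σ ⁻¹' S) := by
  simp only [symmMeasure, Measure.smul_apply, Measure.coe_finsetSum, Finset.sum_apply, smul_eq_mul]
  congr 1
  refine Finset.sum_congr rfl fun σ _ => ?_
  rw [Measure.map_apply (measurable_permS σ) hS]

theorem card_perm_ne_zero : ((Fintype.card (Equiv.Perm (Fin 3)) : ENNReal)) ≠ 0 := by
  exact_mod_cast Fintype.card_ne_zero

theorem card_perm_ne_top : ((Fintype.card (Equiv.Perm (Fin 3)) : ENNReal)) ≠ ⊤ :=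
  ENNReal.natCast_ne_top _

theorem symmMeasure_exch (ν : Measure (Fin 3 → ℝ)) (τ : Equiv.Perm (Fin 3)) :
    (symmMeasure ν).map (permS τ) = symmMeasure ν := by
  ext S hS
  rw [Measure.map_apply (measurable_permS τ) hS, symmMeasure_apply ν (measurable_permS τ hS),
    symmMeasure_apply ν hS]
  congr 1
  refine Fintype.sum_equiv (Equiv.mulRight τ) _ _ fun σ => ?_
  rw [Equiv.coe_mulRight, ← Set.preimage_comp, permS_comp]

theorem symmMeasure_negSet (ν : Measure (Fin 3 → ℝ)) (hoct : ν {s | ∃ i, s i < 0} = 0) :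
    symmMeasure ν {s | ∃ i, s i < 0} = 0 := by
  rw [symmMeasure_apply ν measurableSet_negSet]
  have h : ∀ σ : Equiv.Perm (Fin 3), ν (permS σ ⁻¹' {s | ∃ i, s i < 0}) = 0 := fun σ => by
    rw [preimage_permS_negSet, hoct]
  simp only [h, Finset.sum_const_zero, mul_zero]

theorem symmMeasure_univ (ν : Measure (Fin 3 → ℝ)) : symmMeasure ν Set.univ = ν Set.univ := by
  rw [symmMeasure_apply ν MeasurableSet.univ]
  simp only [Set.preimage_univ, Finset.sum_const, Finset.card_univ, nsmul_eq_mul]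
  rw [← mul_assoc, ENNReal.inv_mul_cancel card_perm_ne_zero card_perm_ne_top, one_mul]

theorem gk_permS (x : Site 3) (σ : Equiv.Perm (Fin 3)) (s : Fin 3 → ℝ) :
    gk x (permS σ s) = gk (fun i => x (σ.symm i)) s := by
  unfold gk permS
  congr 2
  rw [← Equiv.sum_comp σ (fun j => s j * ((x (σ.symm j) : ℝ)) ^ 2)]
  simp

/-- Total mass of a representing measure is `G(0) = 1`. -/
theorem measure_univ_of_rep {ν : Measure (Fin 3 → ℝ)} (h : IsGSMRep ν) : ν Set.univ = 1 := by
  obtain ⟨hfin, -, hrep⟩ := h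
  have h0 := hrep 0
  rw [criticalTwoPoint_zero'] at h0
  simp only [Pi.zero_apply, Int.cast_zero] at h0
  norm_num at h0
  -- h0 : 1 = (ν univ).toReal  (or with `measureReal`)
  exact (ENNReal.toReal_eq_one_iff _).mp h0.symm

theorem integral_gk_symmMeasure {ν : Measure (Fin 3 → ℝ)} (h : IsGSMRep ν) (x : Site 3) :
    ∫ s, gk x s ∂(symmMeasure ν) = criticalTwoPoint 3 x := by
  obtain ⟨hfin, hoct, hrep⟩ := h
  have hint : ∀ σ : Equiv.Perm (Fin 3), Integrable (gk x) (ν.map (permS σ)) := by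
    intro σ
    haveI : IsFiniteMeasure (ν.map (permS σ)) := inferInstance
    refine integrable_gk ?_ x
    rw [Measure.map_apply (measurable_permS σ) measurableSet_negSet, preimage_permS_negSet, hoct]
  unfold symmMeasure
  rw [integral_smul_measure, integral_finsetSum_measure fun σ _ => hint σ]
  have hterm : ∀ σ : Equiv.Perm (Fin 3), ∫ s, gk x s ∂(ν.map (permS σ)) = criticalTwoPoint 3 x := by
    intro σ
    rw [integral_map (measurable_permS σ).aemeasurable (continuous_gk x).aestronglyMeasurable]
    simp_rw [gk_permS]
    rw [← G_perm σ.symm x, hrep]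
    rfl
  simp only [hterm, Finset.sum_const, Finset.card_univ, nsmul_eq_mul, smul_eq_mul,
    ENNReal.toReal_inv, ENNReal.toReal_natCast]
  have hc : ((Fintype.card (Equiv.Perm (Fin 3)) : ℝ)) ≠ 0 := by exact_mod_cast Fintype.card_ne_zero
  field_simp

/-- **Exchangeability and normalisation are free.** -/
theorem gsm_of_rep (h : ∃ ν, IsGSMRep ν) : CriticalTwoPointGSM := by
  obtain ⟨ν, hν⟩ := h
  have hfin : IsFiniteMeasure ν := hν.1
  refine ⟨symmMeasure ν, ⟨?_⟩, symmMeasure_negSet ν hν.2.1, fun σ => symmMeasure_exch ν σ, fun x => ?_⟩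
  · rw [symmMeasure_univ, measure_univ_of_rep hν]
  · exact (integral_gk_symmMeasure hν x).symm

/-- Hence the crux is EQUIVALENT to the bare representation problem. -/
theorem gsm_iff_rep : CriticalTwoPointGSM ↔ ∃ ν, IsGSMRep ν :=
  ⟨fun h => let ⟨ν, _, _, hr⟩ := rep_of_gsm h; ⟨ν, hr⟩, gsm_of_rep⟩

/-! ## F4's rigidity core: why no certificate bites at high temperature

A dual certificate is a polynomial `P(t) = Σ_x c_x t^{x²} ≥ 0` on `[0,1]^d`; near the corner `t → 0`
a negative coefficient `c_x < 0` needs its exponent vector `x²` to be dominated coordinatewise by a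
convex combination of exponent vectors `y_j²` of positive coefficients (Newton polyhedron). The lemma
below shows this is impossible when all `y_j` lie on `ℓ¹`-shells `≥ |x|₁` unless `y_j = x`: so the
lowest `ℓ¹`-shell of every certificate carries only nonnegative coefficients, and since
`G_β(x) = N(x) (tanh β)^{|x|₁}(1 + O(β))` with `N(x) > 0`, `Σ c_x G_β(x) > 0` for `β < β₀(P)`. -/

/-- weighted variance: `Σ w_j (a_j - μ)² = Σ w_j a_j² - μ²` for a probability vector, `μ` the mean. -/
theorem wvar_eq {m : ℕ} (w a : Fin m → ℝ) (hsum : ∑ j, w j = 1) :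
    ∑ j, w j * (a j - ∑ k, w k * a k) ^ 2 = ∑ j, w j * a j ^ 2 - (∑ k, w k * a k) ^ 2 := by
  set μ := ∑ k, w k * a k with hμ
  have e : ∀ j, w j * (a j - μ) ^ 2 = w j * a j ^ 2 - 2 * μ * (w j * a j) + μ ^ 2 * w j := by
    intro j; ring
  simp_rw [e, Finset.sum_add_distrib, Finset.sum_sub_distrib, ← Finset.mul_sum, ← hμ, hsum]
  ring

/-- `(Σ w_j a_j)² ≤ Σ w_j a_j²` (RMS ≥ AM). -/
theorem sq_wmean_le {m : ℕ} (w a : Fin m → ℝ) (hw : ∀ j, 0 ≤ w j) (hsum : ∑ j, w j = 1) :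
    (∑ j, w j * a j) ^ 2 ≤ ∑ j, w j * a j ^ 2 := by
  have key : 0 ≤ ∑ j, w j * (a j - ∑ k, w k * a k) ^ 2 :=
    Finset.sum_nonneg fun j _ => mul_nonneg (hw j) (sq_nonneg _)
  rw [wvar_eq w a hsum] at key
  linarith

/-- equality case: zero weighted variance pins every charged `a_j` to the mean. -/
theorem eq_wmean_of_le {m : ℕ} (w a : Fin m → ℝ) (hw : ∀ j, 0 ≤ w j) (hsum : ∑ j, w j = 1)
    (hle : ∑ j, w j * a j ^ 2 ≤ (∑ j, w j * a j) ^ 2) :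
    ∀ j, 0 < w j → a j = ∑ k, w k * a k := by
  have hzero : ∑ j, w j * (a j - ∑ k, w k * a k) ^ 2 = 0 := by
    apply le_antisymm _ (Finset.sum_nonneg fun j _ => mul_nonneg (hw j) (sq_nonneg _))
    rw [wvar_eq w a hsum]; linarith
  intro j hj
  have h := (Finset.sum_eq_zero_iff_of_nonneg fun k _ => mul_nonneg (hw k) (sq_nonneg _)).mp hzero j
    (Finset.mem_univ j)
  rcases mul_eq_zero.mp h with h | h
  · exact absurd h hj.ne'
  · have : a j - ∑ k, w k * a k = 0 := pow_eq_zero_iff (two_ne_zero) |>.mp h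
    linarith

/-- **RMS–AM rigidity (core of F4).** If `x² ≥ Σ_j w_j y_j²` coordinatewise (`w` a probability vector,
all coordinates nonnegative) and every `y_j` has `ℓ¹`-norm at least that of `x`, then `y_j = x`
whenever `w_j > 0`. -/
theorem rms_am_rigidity {d m : ℕ} (x : Fin d → ℝ) (y : Fin m → Fin d → ℝ) (w : Fin m → ℝ)
    (hx : ∀ i, 0 ≤ x i) (hy : ∀ j i, 0 ≤ y j i) (hw : ∀ j, 0 ≤ w j) (hsum : ∑ j, w j = 1)
    (hdom : ∀ i, ∑ j, w j * (y j i) ^ 2 ≤ (x i) ^ 2) (hshell : ∀ j, ∑ i, x i ≤ ∑ i, y j i) :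
    ∀ j, 0 < w j → y j = x := by
  -- μ i := Σ_j w_j y_ji satisfies μ i ≤ x i
  have hμnn : ∀ i, 0 ≤ ∑ j, w j * y j i :=
    fun i => Finset.sum_nonneg fun j _ => mul_nonneg (hw j) (hy j i)
  have h1 : ∀ i, ∑ j, w j * y j i ≤ x i := by
    intro i
    have hsq : (∑ j, w j * y j i) ^ 2 ≤ x i ^ 2 :=
      (sq_wmean_le w (fun j => y j i) hw hsum).trans (hdom i)
    exact pow_le_pow_iff_left₀ (hμnn i) (hx i) two_ne_zero |>.mp hsq
  -- Σ_i x_i ≤ Σ_j w_j Σ_i y_ji = Σ_i μ_i ≤ Σ_i x_i, so μ = x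
  have h2 : ∑ i, x i ≤ ∑ i, ∑ j, w j * y j i := by
    calc ∑ i, x i = ∑ j, w j * ∑ i, x i := by rw [← Finset.sum_mul, hsum, one_mul]
      _ ≤ ∑ j, w j * ∑ i, y j i :=
          Finset.sum_le_sum fun j _ => mul_le_mul_of_nonneg_left (hshell j) (hw j)
      _ = ∑ i, ∑ j, w j * y j i := by
          simp_rw [Finset.mul_sum]; exact Finset.sum_comm
  have h3 : ∀ i, ∑ j, w j * y j i = x i := by
    have htot : ∑ i, ∑ j, w j * y j i = ∑ i, x i :=
      le_antisymm (Finset.sum_le_sum fun i _ => h1 i) h2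
    intro i
    by_contra hne
    have hlt : ∑ j, w j * y j i < x i := lt_of_le_of_ne (h1 i) hne
    have : ∑ i, ∑ j, w j * y j i < ∑ i, x i :=
      Finset.sum_lt_sum (fun i _ => h1 i) ⟨i, Finset.mem_univ i, hlt⟩
    linarith
  -- equality in RMS ≥ AM for each coordinate
  intro j hj
  funext i
  have hle : ∑ k, w k * (y k i) ^ 2 ≤ (∑ k, w k * y k i) ^ 2 := by
    rw [h3 i]; exact hdom i
  have := eq_wmean_of_le w (fun k => y k i) hw hsum hle j hj
  rw [this, h3 i]

/-!
# Findings (disprover refuter-cdisprove-stmt-CriticalPhenomena-8365-0; cycle 1, 2026-08-16)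

STATUS: **no kill yet**. The crux is a faithful rendering of a genuinely open NUMERICAL conjecture about
`⟨σ₀σ_x⟩⁺_{β_c}` on `ℤ³`; the tree knows `G` only through symmetry, `0 ≤ G ≤ 1`, `G(0) = 1`, MMS
monotonicity, `G → 0`, Simon/IR bounds `c‖x‖∞⁻² ≤ G ≤ C‖x‖∞⁻¹` and the (named) axis Källén–Lehmann fact,
none of which clashes with a Gaussian scale mixture (the massless lattice Green function satisfies all
of them and IS a GSM). A Lean refutation therefore needs a measured/certified violation of a dual-cone
inequality (`dual_cone`); the numerics are running (below).

## Lean content of this file (all sorry-free)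
* `dual_cone`, `dual_cone_of_gsm` — KILL SWITCH: GSM ⇒ `∑ c_k G(x_k) ≥ 0` whenever
  `∑ c_k e^{-⟨s,x_k²⟩} ≥ 0` on the octant (equivalently the polynomial `∑ c_k t^{x_k²} ≥ 0` on `[0,1]³`).
* `mixedDiff_le` — instance: `G(2,0,0)+G(1,1,0) ≤ G(1,0,0)+G(2,1,0)` (the planner's unsigned joint
  mixed difference); `schur_221_le_300` — instance: `G(2,2,1) ≤ G(3,0,0)` (Muirhead `(9,0,0) ≻ (4,4,1)`,
  three Jensen steps + permutation symmetry of `G`). These are the |x| ≤ 3 quantities the MC measures.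
* `measure_plane_eq_zero` (B1) — any representing `ν` gives NO mass to the coordinate planes
  (`G(n eᵢ) → ν{sᵢ=0}` by dominated convergence vs `G → 0`); `measure_near_plane_ne_zero` (B2) — but
  charges every slab `{sᵢ < ε}` (else `G(n eᵢ) ≤ ν(ℝ³)e^{-εn²}` against `c n⁻²`). So `ν` lives on the
  open octant and accumulates at its whole boundary: infinitely many arbitrarily slow clocks.
* `not_finiteGSM` (S1) — the FINITE-mixture strengthening is false; `not_productForm` (S2) — the
  PRODUCT (independent clocks / separable `G`) strengthening is false (`G(n,n,n) = G(n,0,0)³ ≤ C³n⁻³`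
  vs `c n⁻²`): the three clocks must be dependent.
* `gsm_of_rep`, `gsm_iff_rep` — the crux is EQUIVALENT to the bare representation problem
  `∃ ν finite, ν(octantᶜ) = 0, G = ∫ gk dν` (symmetrise over `S₃` — `symmMeasure`, `symmMeasure_exch`,
  `integral_gk_symmMeasure` — and read the mass off `G(0) = 1`, `measure_univ_of_rep`).
* `rms_am_rigidity` (+ `wvar_eq`, `sq_wmean_le`, `eq_wmean_of_le`) — the inequality core of F4: an
  exponent vector `x²` dominating a convex combination of exponent vectors `y_j²` from `ℓ¹`-shells
  `≥ |x|₁` forces `y_j = x`; hence the lowest shell of any corner-positive certificate is nonnegative.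
* tools: `integrable_gk`, `ae_nonneg_of_octant`, `gk_eq`, `gk_single`, `gk_permS`, `exp_jensen3`,
  `G_perm`, `axis_lower_bound`, `false_of_sq_mul_axis_tendsto_zero`, `tendsto_sq_mul_exp_neg`.

## Load-bearing analysis (the crux is an ∃-statement; "hypotheses" = clauses demanded of ν)
* exchangeability and `IsProbabilityMeasure` are NOT load-bearing (`gsm_iff_rep`, proved): provers may
  construct ν without either; refuters may ignore them.
* the octant clause IS load-bearing for the dual cone (signed `s` would allow growing kernels); the
  representation at ALL `x ∈ ℤ³` (not only `x ≠ 0` as in the limit-kernel items) pins `ν(ℝ³) = 1` and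
  forbids an atom "at `s = ∞`" (a `δ₀(x)` component): the closure of the GSM cone on `ℤ³` contains the
  degenerate kernels `𝟙[xᵢ = 0]·e^{-…}` (t = 0 faces of `[0,1]³`), which the crux as typed excludes —
  an NNLS fit that needs such a face component would refute the crux AS TYPED but only "misstate" it.

## Paper / literature findings
* F1 (asymptotic sign, no kill): exchangeable GSM forces the ℓ = 4 cubic anisotropy sign "axes favoured"
  (second-order expansion: `+(D/12)(3Σxᵢ⁴ − |x|⁴)e^{-s̄|x|²}`); Hasenbusch arXiv:2105.09781 §4.2 (read):
  n.n. Ising `r₃ = ξ₍₁₀₀₎/ξ₍₁₁₁₎ > 1`, `r₃ − 1 = a ξ^{-2.006(3)}` — same sign. The free massless lattice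
  Green function has the same sign (`+K₄(x̂)/(12r³)` from `1/q̂² = 1/q² + Σqᵢ⁴/(12q⁴)+…`).
* F2 (correlation-length level, no kill): GSM ⇒ `w ↦ m_β(√w₁,√w₂,√w₃)` (inverse correlation length as
  a function of squared direction cosines) is CONCAVE (log-convexity of Laplace transforms, limit of
  concave functions). For the 2D square lattice the exact high-T mass surface `{cosh a₁ + cosh a₂ = Q(t)}`
  coincides with that of a massive lattice free field (a GSM), so the test is passed identically in the
  solvable member; in 3D the analogous statement is the natural conjecture and is consistent with F1.
* F3 (what a kill must look like): by Riesz extension on `[0,1]³` ∋ 1, `G` is in the CLOSED GSM cone iff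
  `∑ c_x G(x) ≥ 0` for every symmetric "square-lacunary" polynomial `P(t) = ∑ c_x t₁^{x₁²}t₂^{x₂²}t₃^{x₃²} ≥ 0`
  on the cube. For near-radial data the binding constraints are the symmetric `P` vanishing on the
  diagonal `t₁=t₂=t₃` (Muirhead differences = Schur gaps, margin ≈ the 10⁻³ lattice anisotropy) and,
  inside each axis, the lacunary Hausdorff conditions (nodes n², Müntz-sparse ⇒ weak). A violation, if
  any, lives at 2 ≤ |x| ≤ 6 and needs G to ~10⁻⁵: hence the MC design below (difference observables
  have IR-finite variance ~5/N per sweep).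

* F4 (NO certificate bites at high temperature — why the conjecture is robust for small β; paper
  proof, elementary). Let `P(t) = Σ_x c_x t^{x²}` be ≥ 0 near the corner `t → 0⁺` of `[0,1]^d` and let
  `k₀ = min{|x|₁ : c_x ≠ 0}`. CLAIM: `c_x ≥ 0` for every `x` on the shell `|x|₁ = k₀`. (Newton
  polyhedron: a negative monomial `t^{x²}` must be dominated near 0, i.e. `x² ≥ Σ λ_j y_j²`
  coordinatewise for positive-coefficient `y_j` with `|y_j|₁ ≥ k₀`; but then `x_i ≥ (Σλ_j y_{ji}²)^{1/2}
  ≥ Σ λ_j y_{ji}` (RMS ≥ AM), summing `|x|₁ ≥ Σ λ_j |y_j|₁ ≥ k₀ = |x|₁`, forcing `y_j = x` — absurd.)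
  Since `G_β(x) = N(x) (tanh β)^{|x|₁}(1 + O_x(β))` with `N(x) > 0` the number of shortest lattice
  paths, every dual-cone functional has `Σ c_x G_β(x) = (Σ_{|x|₁=k₀} c_x N(x)) t^{k₀} + O(t^{k₀+1}) > 0`
  for `β < β₀(P)`: no FIXED certificate refutes "G_β is a GSM" at small β (the threshold depends on
  P, so this is not a proof of GSM at any fixed β). Violations, if any, need β = O(1) — e.g. β_c — and
  live at intermediate |x| (F3); at |x| → ∞ the smooth scaling expansion with the F1 sign is CM order
  by order. This squares with the ideator's report (card B) that the HT expansion of G has the free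
  CTSRW (hence GSM) form through O(t⁴).

## Numerics — results so far
* F5 (smoke j007861, 2 cores × 0.3 h, L = 16 and 32, |xᵢ| ≤ 6; evidence `smoke-j007861.md`). Sampler validated:
  E_nn(16) = 0.34466(19), E_nn(32) = 0.33596(22) give FSS amplitudes (E_L − 0.330201)·L^{1.4126} = 0.72 / 0.77,
  the expected critical finite-size law. First necessary conditions of GSM hold with LARGE margins:
  `G(3,0,0) − G(2,2,1) = +5.17(1)·10⁻³` (L = 32; the instance `schur_221_le_300`; planner predicted ≈ +2·10⁻³),
  `G(5,0,0) − G(4,3,0) = +0.75(3)·10⁻³` (L = 32, FSS not converged: +1.17(2)·10⁻³ at L = 16),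
  planner's mixed difference (`mixedDiff_le`) `= +0.0935`. Axes are favoured already at r = 3 (F1 sign), and
  difference observables reach 10⁻⁵ in minutes, so the production runs will resolve the GLS-NNLS test to ~2·10⁻⁶.

* F6 (d = 3, β_c, finite L; j014245 on the smoke data; evidence `numerics-round1.md` §B). ALL 14 comparable
  Schur/Muirhead pairs on the spheres |x|² ≤ 72 are positive (≥ +5σ; e.g. `G(4,1,0)−G(3,2,2) = +1.4·10⁻³`,
  `G(5,1,1)−G(3,3,3) = +7.0·10⁻⁴`), all 252 2×2 mixed differences positive, and the GLS-NNLS fit of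
  {G(x)}_{|x|≤5} (27 points, full jackknife covariance) by the exchangeable Gaussian dictionary is PERFECT:
  χ²_min = 8.5·10⁻⁴ at L = 16 (bootstrap null mean 6.7) and 2.6·10⁻⁵ at L = 32 — total mass 1, no mass on the
  closure nodes t = 0, one atom at s = 0 of weight ≈ ⟨m²⟩_L (the torus zero mode) plus anisotropic "needles" and
  near-isotropic slow clocks. Even the finite-volume critical data are inside the cone at this precision.
* F7 (d = 2 EXACT; j008326; evidence `numerics-round1.md` §A). Kac–Ward determinant + FFT Green function on tori
  L ≥ 40 ξ, validated to 1e-15 against Onsager's energy and path independence: at K = 0.2, 0.3, 0.35, 0.4, 0.42 the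
  exact square-lattice Ising two-point function is LP-feasible for the 2D GSM cone on every box |x| ≤ 10
  (misfit 0, max relative residual ≤ 1e-9 except where G < 1e-12), with no closure mass. The interacting
  solvable member d = 2 therefore passes the GSM test — empirical support for the card's "exact in every solvable
  member" beyond free fields (a robustness-radius follow-up, `ising2d/robust.py`, is prepared).

* F8 (production MC, evidence `numerics-round2.md`). β_c, j014271: L = 64 (1106 blocks) and L = 96 (764 blocks),
  window |xᵢ| ≤ 8: ALL 47 comparable Schur pairs positive down to gaps of 8·10⁻⁶ at |x| ≈ 9 (min +5.5σ;
  `G(3,0,0)−G(2,2,1) = 5.263(21)·10⁻³`, `G(5,0,0)−G(4,3,0) = 7.4·10⁻⁴`, `G(5,1,1)−G(3,3,3) = 6.9·10⁻⁴`), all mixed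
  differences positive, and the GLS-NNLS cone test on |x| ≤ 6 (42 points, full covariance) gives χ²_min = 4.8·10⁻⁴
  (L = 64) and 3.5·10⁻⁵ (L = 96) against bootstrap nulls of mean 14–15: GSM-feasible at each L, no closure mass,
  cross-certificates ≤ 0 on the independent size (−1.6σ, −2.8σ). High-T phase, finite-size clean (j014295 β = 0.218,
  L = 48/64/96; j014296 β = 0.21, L = 48/64): E L-independent, all Schur/mixed positive, χ²_min = 0.02–0.07 (β = 0.218)
  and 1.4–1.5 (β = 0.21, p ≈ 0.94) against nulls 5.5–9.2 — feasible. Energies: E(64) = 0.332299(31),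
  E(96) = 0.331395(37) (FSS amplitude 0.75, E_∞ = 0.330201).

* F9 (FINAL combine j017311, evidence `numerics-round3.md`): pooled β_c data L = 48 (1425 blocks), 64 (2097), 96 (1439),
  128 (619). Per L: all 47 Schur pairs positive (≥ +6.8σ), all mixed differences positive, the DIRECTIONAL lacunary LPs
  along axis / face diagonal / body diagonal (k ≤ 8) feasible with misfit 0, split-half certificates never bite. Finite-size
  extrapolation `G_L = G_∞ + a L^{-1.41275} + b L^{-2.24245}` (FSS χ²/pt 0.12; validated by `G_∞(e₁) = 0.33012(11)` vs
  0.33020) and the cone test ON G_∞: χ²_min = 2.1·10⁻⁴ (|x| ≤ 6, 42 pts; null mean 17.9) and 7.2·10⁻³ (|x| ≤ 8, 95 pts;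
  null mean 54.3), no closure mass, worst residual 0.009σ; all 2-parameter variants feasible too. Extrapolated Schur gap
  `G_∞(3,0,0) − G_∞(2,2,1) = 5.295(6)·10⁻³`. The fitted mixing measure: fast spike s ≈ 39·(1,1,1), needles (0.9, 1.4, 39),
  (0.9, 39, 39), mid atoms, and slow near-isotropic clocks 0.05·(1,1,1), 0.013·(1,1,1) — anisotropy dies at small s (F3).

VERDICT (cycle 1, final): no certificate exists within reach — d = 3 at β_c for L = 16…128 separately AND after L → ∞
extrapolation (|x| ≤ 8, precision ~10⁻⁶ in difference directions), d = 3 at β = 0.21, 0.218 with L ≫ ξ, exact d = 2 for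
K ≤ 0.42 (|x| ≤ 10) and at K_c (ideator-1, j006777); every cheap,
asymptotic and high-temperature attack is provably toothless (F1, F2, F4); the strengthenings S1/S2 are false and the
mixing measure is pinned to the open octant with accumulation at every plane (B1/B2, landed as
`Theorems/CriticalTwoPointGSM/Negative/MixingMeasureConstraints.lean`, p99511). THE CRUX RESISTS; the numerical evidence
is, if anything, support for it. WHY it resists a disproof: the only refutation currently conceivable is a finite dual
certificate (a square-lacunary symmetric polynomial P ≥ 0 on [0,1]³ with Σ c_x G(x) < 0), and the measured G sits
inside the cone with margins far above the attainable precision in every direction probed (generic perturbations of the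
size of the statistical errors already give χ² ≈ 15–55 where the data give ≈ 0); no rigorous fact in the tree pins G
beyond what the GSM lattice Green function also satisfies, so no Lean ¬-theorem is available either.
WHY it resists a proof (for the provers, from the same analysis): reflection positivity + MMS + Schrader are Schur-blind
(ideator-3 SDP witnesses), F4 protects only β → 0, the subcritical clause of the picked line is the crux one temperature
lower, and squared coordinates admit no lattice translation (n² + 1 is not a square) — joint complete monotonicity in x²
needs a genuinely new positivity (a coupling / graphical representation producing all three clocks at once, e.g. a
random-time representation of the FK or random-current connectivity conditioned coordinatewise).

## Numerics log (kit jobs of this seat; evidence files smoke-j007861.md, numerics-round{1,2,3}.md)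
* j007861 smoke (sampler validation) · j014087/j014245 smoke analysis · j008326 exact 2D Kac–Ward + LP (K ≤ 0.42) ·
  j014271–j014274 β_c production (L = 32…128) · j014295 (β = 0.218), j014296 (β = 0.21) · j016410 combine test ·
  j017311 FINAL combine (F9) · j016363 2D robustness radius (margins; pending at the time of writing) ·
  scripts in the seat folder: mc3d/main.py (SW sampler), analysis3d/{main,combine}.py, ising2d/{main,robust}.py.

## Line `Sketch` (lead prover-line-stmt-CriticalPhenomena-8365-1) — the picked line and its stub
The lead landed the TRANSFER skeleton sorry-free (Theorems/GaussianScaleMixtureCriticalTwoPointGSM*.lean):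
`criticalTwoPointGSM_iff_tightApproximants` (crux ⇔ pointwise limit of tight probability-GSM kernels;
Prokhorov + portmanteau), `cubeRep_of_approximants` (no tightness: any pointwise limit of
probability-GSM kernels has a CUBE representation `∫ ∏ tᵢ^{xᵢ²} dμ`, μ on `[0,1]³` — exactly the
closure discussed in "Load-bearing analysis" above: cube mass on the faces `tᵢ = 0` is the only gap
between the closed cone and the crux as typed), `exists_exchangeable_rep_of_rep` (= `gsm_of_rep`
here), and `criticalTwoPointGSM_of_subcriticalTightGSM` whose ONLY remaining stub is the physical
input `subcriticalTightGSM`: along some `βₙ ↑ β_c`, the free two-point functions `⟨σ₀σ_x⟩^∅_{βₙ}`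
are GSM with probability measures on the closed octant forming a TIGHT family.
Disprover's assessment of the stub (no kill):
* GSM clause at β < β_c: NUMERICALLY SUPPORTED — the finite-size-clean runs at β = 0.21 (ξ ≈ 3) and
  β = 0.218 (ξ ≈ 6.5) are GSM-feasible on |x| ≤ 6 (F8), as is the exact 2D analogue at five
  temperatures (F7). But logically the clause is the crux in a costume one temperature lower: joint
  complete monotonicity in x² is exactly as unproved at β = 0.218 as at β_c (F4 only protects β → 0);
  the transfer theorem relocates the difficulty, it does not split it. A lead cycle spent on
  `subcriticalTightGSM` is a cycle on the crux itself unless a genuinely subcritical lever (OZ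
  analyticity strip, Paley–Wiener type, transfer-matrix gap) is named that produces POSITIVITY of
  mixed x²-differences — none of the filed cards does more than assert it.
* Tightness clause: plausible GIVEN the GSM clause — no divergence develops at short distance as
  β ↑ β_c (G_β(e₁) → 0.3302…), the fitted measures at β = 0.21, 0.218, β_c all live at s ≤ 50 with no
  closure mass, and mass escaping to sᵢ → ∞ would only be needed to represent a developing jump of G
  across |xᵢ| ≤ 1, which does not happen. What tightness buys: without it one still gets a CUBE
  representation of the limit (`cubeRep_of_approximants`), and the only defect is possible mass on
  the faces {tᵢ = 0} (sᵢ = ∞), which contributes only to G on the planes {xᵢ = 0} and is invisible to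
  every decay argument ((B1) kills the opposite faces {sᵢ = 0}). So tightness is precisely the
  load-bearing content of the transfer beyond GSM itself; an equivalent, directly testable form for
  the lead: `limsup_β ν_β{max sᵢ > M} → 0 as M → ∞` (all fitted atoms here have max sᵢ ≤ 50).
* Joint sufficiency: fine (the transfer is a theorem). Stub signature: fine (free state, sequence,
  probability normalisation automatic from G_β(0) = 1).

## Targets
(none stuck: `stuck_stubs = []`; the line's single open stub `subcriticalTightGSM` is assessed above —
not refutable by this seat's means, numerically supported in its GSM clause.)
-/

end

end Summit.CriticalPhenomena.Ising3DConformalLimit.Cruxes.CriticalTwoPointGSM.Disproof
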